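import Summits.AtomisticToContinuum.Crystallization.Theorems.ChargedEnergyGapGeoKernels
import HarnessLib

/-!
# Charged energy gap — lens-3 g65, node «BarlowRef» (R3) — part 26b «RowSchema»: generator-facing row theorems, the discrete Abel step and the level-monotone cored count

Cell `decomp-a2c`, seat lens-3, generation 65.  Imports part 26a (`…GeoKernels`).  ELEMENTARY·PROVED.  This file is the interface between the typed
kernels and a MACHINE-WRITTEN certificate (parts 26c «KernelTable», 26d «BandSums»): every hypothesis a certificate row has to discharge is a closed
polynomial inequality between RATIONAL row data, so that a row is one term application with `norm_num` side goals.

* SHELL ENVELOPES `slope_of_shell`, `ratio_of_shell`: the per-source side conditions of parts 18/20 (`r² ≤ κ²(a² − r²)`, `ρ²a² ≤ a² − r²`) follow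
  from the same inequality at the shell's inner radius `A ≤ a`.
* START DISCHARGERS `start_dist_of_sep` (pair separation `b₀`), `start_dist_of_foot` (part 18 `add_le_dist_of_test` with `q₁² ≤ A² − r²`,
  `q₂² ≤ b_c² − r²`), `start_axial_of_shell` (part 18 `le_axial_of_excl` for a whole shell `A ≤ a ≤ A'`: the convex condition
  `(α₀ − a)² + κ²α₀² ≤ b_c²` is checked at both endpoints).
* ROW THEOREMS, axis-free and numeric: `inside_row_le`, `half_row_le`, `tube_row_le` conclude `row·V ≤ g` from the row data and ONE rational
  inequality `3927/1250 · Q(data) ≤ g` (`Q` = the closed form of part 26a with `π` factored out: `isoGeoQ`, `halfGeoQ`, `tubeQ`; `π < 3.1416`).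
* `shell_abel_le`: the discrete Abel step — per-source row bounds `g_j` on shells `[t_j, t_{j+1})` (antitone in `j`) and CUMULATIVE source counts
  `N_{k+1} ≥ #{d < t_{k+1}}` give `Σ_x w_x ≤ g_m·N_T + Σ_{k<m} (g_k − g_{k+1})·N_{k+1}`.
* `card_mul_le_cap_of_level`: the cored source count in LEVEL-MONOTONE form — sources within `A` of the member and outside `B(x₀, ϱ)`, member level
  `0 < dist x₀ c ≤ ℓ`, lie in the cap of `B̄(c, A + 9/5)` above the plane `t(ℓ) = ((ϱ − 9/5)² − ℓ² − (A + 9/5)²)/(2ℓ)` (part 14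
  `near_cored_subset_cap` + the monotonicity of `t` in the level), so `#T·V ≤ capVol (A + 9/5) t` for any `t ≤ max (t ℓ) (−(A + 9/5))` in range.

0 sorry; standard axioms.
-/

noncomputable section

open scoped Classical RealInnerProductSpace ENNReal
open MeasureTheory
open Literature.MathematicalPhysics.StatisticalMechanics Literature.Geometry.DiscreteGeometry
open Summit.AtomisticToContinuum.Crystallization.Theses.PricedLinkCensus
open Summit.AtomisticToContinuum.Crystallization.Theorems.ChargedEnergyGapNegative

namespace Summit.AtomisticToContinuum.Crystallization.Theorems.ChargedEnergyGapChartDial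

section RowSchema

/-! ## Shell envelopes -/

/-- The slope condition of a shell: `r² ≤ κ²(A² − r²)` and `0 ≤ A ≤ a` give `r² ≤ κ²(a² − r²)`. -/
theorem slope_of_shell {r κ A a : ℝ} (hA : 0 ≤ A) (hκ : r ^ 2 ≤ κ ^ 2 * (A ^ 2 - r ^ 2)) (ha : A ≤ a) :
    r ^ 2 ≤ κ ^ 2 * (a ^ 2 - r ^ 2) := by
  have hsq : A ^ 2 ≤ a ^ 2 := pow_le_pow_left₀ hA ha 2
  nlinarith [mul_le_mul_of_nonneg_left hsq (sq_nonneg κ)]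

/-- The cap-ratio condition of a shell: `ρ²A² ≤ A² − r²` and `0 < A ≤ a` give `ρ²a² ≤ a² − r²`. -/
theorem ratio_of_shell {r ρ A a : ℝ} (hA : 0 < A) (hρ : ρ ^ 2 * A ^ 2 ≤ A ^ 2 - r ^ 2) (ha : A ≤ a) :
    ρ ^ 2 * a ^ 2 ≤ a ^ 2 - r ^ 2 := by
  have hsq : A ^ 2 ≤ a ^ 2 := pow_le_pow_left₀ hA.le ha 2
  have hA2 : 0 < A ^ 2 := by positivity
  have hρ1 : ρ ^ 2 ≤ 1 := by
    by_contra hc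
    rw [not_le] at hc
    nlinarith [sq_nonneg r, mul_lt_mul_of_pos_right hc hA2]
  nlinarith [mul_le_mul_of_nonneg_left hsq (sub_nonneg.2 hρ1)]

/-! ## Start dischargers -/

/-- Distance start from the pair separation `b₀ ≤ dist y z`. -/
theorem start_dist_of_sep {y c : E3} {r b₀ γ : ℝ} {T : Finset E3} (hsep : ∀ z ∈ T, b₀ ≤ dist y z) (hγ : γ ≤ b₀) :
    ∀ z ∈ T, y ≠ z → Metric.infDist c (segment ℝ y z) ≤ r → γ ≤ dist y z :=
  fun z hz _ _ => hγ.trans (hsep z hz)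

/-- Distance start from the perpendicular feet (part 18 `add_le_dist_of_test`) with shell data: `q₁² ≤ A² − r²`, `q₂² ≤ b_c² − r²`. -/
theorem start_dist_of_foot {y c : E3} {r A b_c q₁ q₂ γ : ℝ} {T : Finset E3} (hr : 0 ≤ r) (hrA : r < A) (hA : A ≤ dist y c)
    (hrb : r < b_c) (hGc : ∀ z ∈ T, b_c ≤ dist z c) (hq₁ : q₁ ^ 2 ≤ A ^ 2 - r ^ 2) (hq₂ : q₂ ^ 2 ≤ b_c ^ 2 - r ^ 2) (hγ : γ ≤ q₁ + q₂) :
    ∀ z ∈ T, y ≠ z → Metric.infDist c (segment ℝ y z) ≤ r → γ ≤ dist y z := by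
  intro z hz _ hinf
  have hry : r < dist y c := hrA.trans_le hA
  have hrz : r < dist z c := hrb.trans_le (hGc z hz)
  have h1 : q₁ ^ 2 ≤ dist y c ^ 2 - r ^ 2 := hq₁.trans (by nlinarith [pow_le_pow_left₀ (hr.trans hrA.le) hA 2])
  have h2 : q₂ ^ 2 ≤ dist z c ^ 2 - r ^ 2 := hq₂.trans (by nlinarith [pow_le_pow_left₀ (hr.trans hrb.le) (hGc z hz) 2])
  exact hγ.trans (add_le_dist_of_test hinf hry hrz h1 h2)

/-- Distance start `γ ≤ max b₀ (q₁ + q₂)`. -/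
theorem start_dist_of_max {y c : E3} {r A b₀ b_c q₁ q₂ γ : ℝ} {T : Finset E3} (hr : 0 ≤ r) (hrA : r < A) (hA : A ≤ dist y c)
    (hrb : r < b_c) (hsep : ∀ z ∈ T, b₀ ≤ dist y z) (hGc : ∀ z ∈ T, b_c ≤ dist z c) (hq₁ : q₁ ^ 2 ≤ A ^ 2 - r ^ 2)
    (hq₂ : q₂ ^ 2 ≤ b_c ^ 2 - r ^ 2) (hγ : γ ≤ max b₀ (q₁ + q₂)) :
    ∀ z ∈ T, y ≠ z → Metric.infDist c (segment ℝ y z) ≤ r → γ ≤ dist y z := by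
  rcases le_max_iff.1 hγ with h | h
  · exact start_dist_of_sep hsep h
  · exact start_dist_of_foot hr hrA hA hrb hGc hq₁ hq₂ h

/-- ★ Axial start for a whole source shell `A ≤ dist y c ≤ A'` from the exclusion `b_c ≤ dist z c` (part 18 `le_axial_of_excl`): slope `κ` with
`r² ≤ κ²(A² − r²)`, `A' − r ≤ α₀`, `r² + κ²(A' − r)² < b_c²` and the convex condition `(α₀ − a)² + κ²α₀² ≤ b_c²` at BOTH endpoints `a = A, A'`. -/
theorem start_axial_of_shell {b : OrthonormalBasis (Fin 3) ℝ E3} {c y : E3} {r κ b_c α₀ A A' : ℝ} {T : Finset E3}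
    (hb : b 2 = (dist y c)⁻¹ • (c - y)) (hr : 0 ≤ r) (hrA : r < A) (hA : A ≤ dist y c) (hA' : dist y c ≤ A')
    (hκ : r ^ 2 ≤ κ ^ 2 * (A ^ 2 - r ^ 2)) (hbc : 0 ≤ b_c) (hGc : ∀ z ∈ T, b_c ≤ dist z c) (hα : A' - r ≤ α₀)
    (h1 : r ^ 2 + κ ^ 2 * (A' - r) ^ 2 < b_c ^ 2) (h2 : (α₀ - A) ^ 2 + κ ^ 2 * α₀ ^ 2 ≤ b_c ^ 2)
    (h2' : (α₀ - A') ^ 2 + κ ^ 2 * α₀ ^ 2 ≤ b_c ^ 2) :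
    ∀ z ∈ T, y ≠ z → Metric.infDist c (segment ℝ y z) ≤ r → α₀ ≤ ⟪b 2, z - y⟫ := by
  intro z hz _ hinf
  obtain ⟨p, hp, hpc⟩ := exists_mem_segment_dist_le hinf
  have hry : r < dist y c := hrA.trans_le hA
  have hκr : r ^ 2 ≤ κ ^ 2 * (dist y c ^ 2 - r ^ 2) := slope_of_shell (hr.trans hrA.le) hκ hA
  refine le_axial_of_excl hb hp hpc hry hκr hbc (hGc z hz) (by linarith) ?_ ?_
  · have hsq : (dist y c - r) ^ 2 ≤ (A' - r) ^ 2 := pow_le_pow_left₀ (by linarith) (by linarith) 2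
    nlinarith [mul_le_mul_of_nonneg_left hsq (sq_nonneg κ)]
  · by_cases hle : dist y c ≤ α₀
    · have hsq : (α₀ - dist y c) ^ 2 ≤ (α₀ - A) ^ 2 := pow_le_pow_left₀ (by linarith) (by linarith) 2
      linarith
    · rw [not_le] at hle
      have hsq : (dist y c - α₀) ^ 2 ≤ (A' - α₀) ^ 2 := pow_le_pow_left₀ (by linarith) (by linarith) 2
      have e1 : (α₀ - dist y c) ^ 2 = (dist y c - α₀) ^ 2 := by ring
      have e2 : (α₀ - A') ^ 2 = (A' - α₀) ^ 2 := by ring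
      linarith

/-! ## The closed forms with `π` factored out -/

/-- `isoGeo = π · isoGeoQ`. -/
def isoGeoQ (γ q : ℝ) : ℝ :=
  (4 * (q ^ 3 - 1) / 3) * geoClassSum γ q 3 + (4 * (9 / 5) * (q ^ 2 + 1)) * geoClassSum γ q 4 +
    (4 * (9 / 5) ^ 2 * (q - 1)) * geoClassSum γ q 5 + (8 * (9 / 5) ^ 3 / 3) * geoClassSum γ q 6

/-- `isoGeo_eq` (docstring added by the landing lane; see the module docstring). [formal bookkeeping] -/
theorem isoGeo_eq (γ q : ℝ) : isoGeo γ q = Real.pi * isoGeoQ γ q := by unfold isoGeo isoGeoQ; ring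

/-- `halfGeo = π · halfGeoQ`. -/
def halfGeoQ (ρ γ q : ℝ) : ℝ :=
  (((q - ρ) ^ 2 * (2 * q + ρ) - (1 - ρ) ^ 2 * (2 + ρ)) / 3) * geoClassSum γ q 3 +
    ((9 / 5) * ((q - ρ) ^ 2 + 4 * (q - ρ) * (2 * q + ρ) + 3 * (1 - ρ) ^ 2) / 3) * geoClassSum γ q 4 +
    (4 * (9 / 5) ^ 2 * q) * geoClassSum γ q 5 + (4 * (9 / 5) ^ 3 / 3) * geoClassSum γ q 6

/-- `halfGeo_eq` (docstring added by the landing lane; see the module docstring). [formal bookkeeping] -/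
theorem halfGeo_eq (ρ γ q : ℝ) : halfGeo ρ γ q = Real.pi * halfGeoQ ρ γ q := by unfold halfGeo halfGeoQ; ring

/-- `coneGeo = π · coneGeoQ`. -/
def coneGeoQ (κ γ q : ℝ) : ℝ :=
  (κ ^ 2 * (q ^ 3 - 1) / 3) * geoClassSum γ q 3 +
    (κ ^ 2 * (9 / 5) * (q ^ 2 + 1) + κ * ((κ + 1) * (9 / 5)) * (q ^ 2 - 1)) * geoClassSum γ q 4 +
    (κ ^ 2 * (9 / 5) ^ 2 * (q - 1) + 2 * κ * ((κ + 1) * (9 / 5)) * (9 / 5) * (q + 1) + ((κ + 1) * (9 / 5)) ^ 2 * (q - 1)) *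
      geoClassSum γ q 5 +
    (2 * κ ^ 2 * (9 / 5) ^ 3 / 3 + 2 * ((κ + 1) * (9 / 5)) ^ 2 * (9 / 5)) * geoClassSum γ q 6

/-- `coneGeo_eq` (docstring added by the landing lane; see the module docstring). [formal bookkeeping] -/
theorem coneGeo_eq (κ γ q : ℝ) : coneGeo κ γ q = Real.pi * coneGeoQ κ γ q := by unfold coneGeo coneGeoQ; ring

/-- `coneVol κ μ α β = π · coneVolQ κ μ α β`. -/
def coneVolQ (κ μ α β : ℝ) : ℝ := κ ^ 2 * (β ^ 3 - α ^ 3) / 3 + κ * μ * (β ^ 2 - α ^ 2) + μ ^ 2 * (β - α)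

/-- `coneVol_eq` (docstring added by the landing lane; see the module docstring). [formal bookkeeping] -/
theorem coneVol_eq (κ μ α β : ℝ) : coneVol κ μ α β = Real.pi * coneVolQ κ μ α β := by unfold coneVol coneVolQ; ring

/-- `coneVolQ_nonneg` (docstring added by the landing lane; see the module docstring). [formal bookkeeping] -/
theorem coneVolQ_nonneg {κ μ α β : ℝ} (hκ : 0 ≤ κ) (hμ : 0 ≤ μ) (hα : 0 ≤ α) (hαβ : α ≤ β) : 0 ≤ coneVolQ κ μ α β := by
  unfold coneVolQ
  have h2 : α ^ 2 ≤ β ^ 2 := pow_le_pow_left₀ hα hαβ 2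
  have h3 : α ^ 3 ≤ β ^ 3 := pow_le_pow_left₀ hα hαβ 3
  have t1 : 0 ≤ κ ^ 2 * (β ^ 3 - α ^ 3) / 3 := by have := sq_nonneg κ; have := sub_nonneg.2 h3; positivity
  have t2 : 0 ≤ κ * μ * (β ^ 2 - α ^ 2) := mul_nonneg (mul_nonneg hκ hμ) (sub_nonneg.2 h2)
  have t3 : 0 ≤ μ ^ 2 * (β - α) := mul_nonneg (sq_nonneg μ) (sub_nonneg.2 hαβ)
  linarith

/-- The tube-regime total with `π` factored out: first axial class `[α₀, γ)` at weight `m₀⁻⁶` plus the geometric classes. -/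
def tubeQ (κ α₀ m₀ γ q : ℝ) : ℝ := coneVolQ κ ((κ + 1) * (9 / 5)) (α₀ - 9 / 5) (γ + 9 / 5) * m₀⁻¹ ^ 6 + coneGeoQ κ γ q

/-- `π < 3927/1250`: a bound `X ≤ π·Q` with `0 ≤ X` becomes numeric. -/
theorem le_of_le_pi_mul {X Q g : ℝ} (hX : 0 ≤ X) (h : X ≤ Real.pi * Q) (hg : 3927 / 1250 * Q ≤ g) : X ≤ g := by
  have hπ : Real.pi < 3927 / 1250 := by have := Real.pi_lt_d4; norm_num at this ⊢; linarith
  by_cases hQ : 0 ≤ Q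
  · exact h.trans ((mul_le_mul_of_nonneg_right hπ.le hQ).trans hg)
  · rw [not_le] at hQ
    have : Real.pi * Q < 0 := mul_neg_of_pos_of_neg Real.pi_pos hQ
    linarith [mul_neg_of_pos_of_neg (by norm_num : (0 : ℝ) < 3927 / 1250) hQ]

/-- The row `(Σ_z [test]·(dist y z)⁻⁶)·V` is nonnegative (window data `0 < a`, `0 < h`). -/
theorem row_mul_nonneg {a h : ℝ} (ha : 9 / 10 ≤ a ∧ a ≤ 11 / 10) (hh : 0 < h ∧ 27 / 50 * a ^ 2 ≤ h ^ 2 ∧ h ^ 2 ≤ 121 / 150 * a ^ 2)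
    (y c : E3) (r : ℝ) (T : Finset E3) :
    0 ≤ (∑ z ∈ T, if y ≠ z ∧ Metric.infDist c (segment ℝ y z) ≤ r then (dist y z)⁻¹ ^ 6 else 0) * (a * (a * √3 / 2) * h) := by
  have ha0 : 0 ≤ a := by linarith [ha.1]
  have hV0 : 0 ≤ a * (a * √3 / 2) * h := by have := hh.1.le; positivity
  refine mul_nonneg (Finset.sum_nonneg fun z _ => ?_) hV0
  split_ifs
  · positivity
  · exact le_rfl

/-! ## The three numeric row theorems -/

/-- ★ INSIDE ROW: distance start from the pair separation (`γ ≤ b₀`, `18/5 ≤ γ`), any `q > 1`, numeric closer `3927/1250·isoGeoQ γ q ≤ g`. -/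
theorem inside_row_le {a h : ℝ} {s : ℤ → ℤ} {g : E3 → E3}
    (ha : 9 / 10 ≤ a ∧ a ≤ 11 / 10) (hh : 0 < h ∧ 27 / 50 * a ^ 2 ≤ h ^ 2 ∧ h ^ 2 ≤ 121 / 150 * a ^ 2) (hg : Isometry g)
    (y c : E3) (r : ℝ) {b₀ γ q g₀ : ℝ} (hγb : γ ≤ b₀) (hγ : 18 / 5 ≤ γ) (hq : 1 < q) (hnum : 3927 / 1250 * isoGeoQ γ q ≤ g₀)
    (T : Finset E3) (hT : ↑T ⊆ g '' barlowStacking a h s) (hsep : ∀ z ∈ T, b₀ ≤ dist y z) :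
    (∑ z ∈ T, if y ≠ z ∧ Metric.infDist c (segment ℝ y z) ≤ r then (dist y z)⁻¹ ^ 6 else 0) * (a * (a * √3 / 2) * h) ≤ g₀ :=
  le_of_le_pi_mul (row_mul_nonneg ha hh y c r T)
    ((inside_geometric_mul_le ha hh hg y c r hγ hq T hT (start_dist_of_sep hsep hγb)).trans_eq (isoGeo_eq γ q)) hnum

/-- ★ INSIDE ROW with the foot start available (`r < A ≤ dist y c`, `γ ≤ max b₀ (q₁ + q₂)`). -/
theorem inside_row_foot_le {a h : ℝ} {s : ℤ → ℤ} {g : E3 → E3}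
    (ha : 9 / 10 ≤ a ∧ a ≤ 11 / 10) (hh : 0 < h ∧ 27 / 50 * a ^ 2 ≤ h ^ 2 ∧ h ^ 2 ≤ 121 / 150 * a ^ 2) (hg : Isometry g)
    {y c : E3} {r A b₀ b_c q₁ q₂ γ q g₀ : ℝ} (hr : 0 ≤ r) (hrA : r < A) (hA : A ≤ dist y c) (hrb : r < b_c)
    (hq₁ : q₁ ^ 2 ≤ A ^ 2 - r ^ 2) (hq₂ : q₂ ^ 2 ≤ b_c ^ 2 - r ^ 2) (hγm : γ ≤ max b₀ (q₁ + q₂)) (hγ : 18 / 5 ≤ γ) (hq : 1 < q)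
    (hnum : 3927 / 1250 * isoGeoQ γ q ≤ g₀)
    (T : Finset E3) (hT : ↑T ⊆ g '' barlowStacking a h s) (hsep : ∀ z ∈ T, b₀ ≤ dist y z) (hGc : ∀ z ∈ T, b_c ≤ dist z c) :
    (∑ z ∈ T, if y ≠ z ∧ Metric.infDist c (segment ℝ y z) ≤ r then (dist y z)⁻¹ ^ 6 else 0) * (a * (a * √3 / 2) * h) ≤ g₀ :=
  le_of_le_pi_mul (row_mul_nonneg ha hh y c r T)
    ((inside_geometric_mul_le ha hh hg y c r hγ hq T hT (start_dist_of_max hr hrA hA hrb hsep hGc hq₁ hq₂ hγm)).trans_eq (isoGeo_eq γ q))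
    hnum

/-- ★ HALF ROW: `0 ≤ r < A ≤ dist y c`, cap ratio `ρ` with `ρ²A² ≤ A² − r²`, distance start `γ ≤ max b₀ (q₁ + q₂)`, numeric closer
`3927/1250·halfGeoQ ρ γ q ≤ g`. -/
theorem half_row_le {a h : ℝ} {s : ℤ → ℤ} {g : E3 → E3}
    (ha : 9 / 10 ≤ a ∧ a ≤ 11 / 10) (hh : 0 < h ∧ 27 / 50 * a ^ 2 ≤ h ^ 2 ∧ h ^ 2 ≤ 121 / 150 * a ^ 2) (hg : Isometry g)
    {y c : E3} {r A ρ b₀ b_c q₁ q₂ γ q g₀ : ℝ} (hr : 0 ≤ r) (hrA : r < A) (hA : A ≤ dist y c)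
    (hρ0 : 0 ≤ ρ) (hρ : ρ ^ 2 * A ^ 2 ≤ A ^ 2 - r ^ 2) (hrb : r < b_c)
    (hq₁ : q₁ ^ 2 ≤ A ^ 2 - r ^ 2) (hq₂ : q₂ ^ 2 ≤ b_c ^ 2 - r ^ 2) (hγm : γ ≤ max b₀ (q₁ + q₂)) (hγ : 18 / 5 ≤ γ) (hq : 1 < q)
    (hnum : 3927 / 1250 * halfGeoQ ρ γ q ≤ g₀)
    (T : Finset E3) (hT : ↑T ⊆ g '' barlowStacking a h s) (hsep : ∀ z ∈ T, b₀ ≤ dist y z) (hGc : ∀ z ∈ T, b_c ≤ dist z c) :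
    (∑ z ∈ T, if y ≠ z ∧ Metric.infDist c (segment ℝ y z) ≤ r then (dist y z)⁻¹ ^ 6 else 0) * (a * (a * √3 / 2) * h) ≤ g₀ :=
  le_of_le_pi_mul (row_mul_nonneg ha hh y c r T)
    ((half_geometric_mul_le ha hh hg hr (hrA.trans_le hA) hρ0 (ratio_of_shell (hr.trans_lt hrA) hρ hA) hγ hq T hT
      (start_dist_of_max hr hrA hA hrb hsep hGc hq₁ hq₂ hγm)).trans_eq (halfGeo_eq ρ γ q)) hnum

/-- ★★ TUBE ROW (axis-free): shell `0 ≤ r < A ≤ dist y c ≤ A'`, slope `κ ≥ 0` with `r² ≤ κ²(A² − r²)`, exclusion start `α₀` (conditions of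
`start_axial_of_shell`, `9/5 ≤ α₀`), foot start `q₁ + q₂`, first-class weight `m₀⁻⁶` with `0 < m₀`, `m₀ ≤ α₀ ∨ m₀ ≤ q₁ + q₂`, geometric classes from
`γ ≥ max(α₀, q₁ + q₂, 18/5)` with ratio `q > 1`, numeric closer `3927/1250·tubeQ κ α₀ m₀ γ q ≤ g`. -/
theorem tube_row_le {a h : ℝ} {s : ℤ → ℤ} {g : E3 → E3}
    (ha : 9 / 10 ≤ a ∧ a ≤ 11 / 10) (hh : 0 < h ∧ 27 / 50 * a ^ 2 ≤ h ^ 2 ∧ h ^ 2 ≤ 121 / 150 * a ^ 2) (hg : Isometry g)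
    {y c : E3} {r A A' κ b_c α₀ q₁ q₂ m₀ γ q g₀ : ℝ}
    (hr : 0 ≤ r) (hrA : r < A) (hA : A ≤ dist y c) (hA' : dist y c ≤ A')
    (hκ0 : 0 ≤ κ) (hκ : r ^ 2 ≤ κ ^ 2 * (A ^ 2 - r ^ 2)) (hrb : r < b_c)
    (hα : A' - r ≤ α₀) (hαD : 9 / 5 ≤ α₀) (h1 : r ^ 2 + κ ^ 2 * (A' - r) ^ 2 < b_c ^ 2)
    (h2 : (α₀ - A) ^ 2 + κ ^ 2 * α₀ ^ 2 ≤ b_c ^ 2) (h2' : (α₀ - A') ^ 2 + κ ^ 2 * α₀ ^ 2 ≤ b_c ^ 2)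
    (hq₁ : q₁ ^ 2 ≤ A ^ 2 - r ^ 2) (hq₂ : q₂ ^ 2 ≤ b_c ^ 2 - r ^ 2)
    (hm0 : 0 < m₀) (hm : m₀ ≤ α₀ ∨ m₀ ≤ q₁ + q₂) (hαγ : α₀ ≤ γ) (hdγ : q₁ + q₂ ≤ γ) (hγ : 18 / 5 ≤ γ) (hq : 1 < q)
    (hnum : 3927 / 1250 * tubeQ κ α₀ m₀ γ q ≤ g₀)
    (T : Finset E3) (hT : ↑T ⊆ g '' barlowStacking a h s) (hGc : ∀ z ∈ T, b_c ≤ dist z c) :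
    (∑ z ∈ T, if y ≠ z ∧ Metric.infDist c (segment ℝ y z) ≤ r then (dist y z)⁻¹ ^ 6 else 0) * (a * (a * √3 / 2) * h) ≤ g₀ := by
  have hry : r < dist y c := hrA.trans_le hA
  have hyc : y ≠ c := fun h0 => by rw [h0, dist_self] at hry; exact (not_lt.2 hr) hry
  obtain ⟨b, hb⟩ := exists_orthonormalBasis_axis hyc
  have hα0 : 0 < α₀ := by linarith
  have hker := source_geometric_mul_le ha hh hg hb hr hry hκ0 (slope_of_shell (hr.trans hrA.le) hκ hA) hα0 hαγ hdγ hγ hq T hT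
    (start_axial_of_shell hb hr hrA hA hA' hκ (hr.trans hrb.le) hGc hα h1 h2 h2') (start_dist_of_foot hr hrA hA hrb hGc hq₁ hq₂ le_rfl)
  -- replace the first-class weight `(max α₀ (q₁+q₂))⁻⁶` by `m₀⁻⁶`
  have hmax : m₀ ≤ max α₀ (q₁ + q₂) := hm.elim (fun h0 => h0.trans (le_max_left _ _)) fun h0 => h0.trans (le_max_right _ _)
  have hw : (max α₀ (q₁ + q₂))⁻¹ ^ 6 ≤ m₀⁻¹ ^ 6 :=
    pow_le_pow_left₀ (inv_nonneg.2 (hm0.le.trans hmax)) ((inv_le_inv₀ (hm0.trans_le hmax) hm0).2 hmax) 6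
  have hcv : 0 ≤ coneVol κ ((κ + 1) * (9 / 5)) (α₀ - 9 / 5) (γ + 9 / 5) := by
    rw [coneVol_eq]
    exact mul_nonneg Real.pi_pos.le (coneVolQ_nonneg hκ0 (by positivity) (by linarith) (by linarith))
  refine le_of_le_pi_mul (row_mul_nonneg ha hh y c r T) (hker.trans ?_) hnum
  rw [coneVol_eq, coneGeo_eq, tubeQ]
  rw [coneVol_eq] at hcv
  nlinarith [mul_le_mul_of_nonneg_left hw hcv]

/-! ## The discrete Abel step over source shells -/

/-- Local monotonicity below `m` chains. -/
theorem le_chain_of_succ {t : ℕ → ℝ} {m : ℕ} (ht : ∀ k < m, t k ≤ t (k + 1)) {i j : ℕ} (hij : i ≤ j) (hjm : j ≤ m) :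
    t i ≤ t j := by
  induction j with
  | zero => rw [Nat.le_zero.1 hij]
  | succ n ih =>
    rcases Nat.lt_or_ge i (n + 1) with h | h
    · exact (ih (Nat.lt_succ_iff.1 h) (Nat.le_of_succ_le hjm)).trans (ht n (Nat.lt_of_succ_le hjm))
    · rw [le_antisymm hij h]

/-- ★ DISCRETE ABEL: sources `x ∈ T` with a shell index `j ≤ m` (`d x < t (j+1)` unless `j = m`) and row bounds `w x ≤ g j`, `g` antitone, `0 ≤ g m`,
cumulative counts `#{x : d x < t (k+1)} ≤ N (k+1)` (`k < m`) and `#T ≤ N_T` ⟹ `Σ w ≤ g m · N_T + Σ_{k<m} (g k − g (k+1)) · N (k+1)`. -/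
theorem shell_abel_le {ι : Type*} (T : Finset ι) (d w : ι → ℝ) (t g N : ℕ → ℝ) (m : ℕ) {NT : ℝ}
    (ht : ∀ k < m, t k ≤ t (k + 1)) (hg : ∀ k < m, g (k + 1) ≤ g k) (hgm : 0 ≤ g m)
    (hw : ∀ x ∈ T, ∃ j ≤ m, (d x < t (j + 1) ∨ j = m) ∧ w x ≤ g j)
    (hN : ∀ k < m, ((T.filter fun x => d x < t (k + 1)).card : ℝ) ≤ N (k + 1)) (hNT : (T.card : ℝ) ≤ NT) :
    ∑ x ∈ T, w x ≤ g m * NT + ∑ k ∈ Finset.range m, (g k - g (k + 1)) * N (k + 1) := by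
  have hdiff : ∀ k < m, 0 ≤ g k - g (k + 1) := fun k hk => sub_nonneg.2 (hg k hk)
  have hpt : ∀ x ∈ T, w x ≤ g m + ∑ k ∈ Finset.range m, (if d x < t (k + 1) then g k - g (k + 1) else 0) := by
    intro x hx
    obtain ⟨j, hjm, hj, hwx⟩ := hw x hx
    have htel : ∑ k ∈ Finset.Ico j m, (g k - g (k + 1)) = g j - g m := by
      rw [Finset.sum_Ico_eq_sub _ hjm, Finset.sum_range_sub', Finset.sum_range_sub']; ring
    have hind : ∀ k ∈ Finset.Ico j m, (if d x < t (k + 1) then g k - g (k + 1) else 0) = g k - g (k + 1) := by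
      intro k hk
      rw [Finset.mem_Ico] at hk
      rcases hj with hj | hj
      · rw [if_pos (hj.trans_le (le_chain_of_succ ht (Nat.succ_le_succ hk.1) (Nat.succ_le_of_lt hk.2)))]
      · exfalso; omega
    calc w x ≤ g j := hwx
      _ = g m + ∑ k ∈ Finset.Ico j m, (if d x < t (k + 1) then g k - g (k + 1) else 0) := by
          rw [Finset.sum_congr rfl hind, htel]; ring
      _ ≤ g m + ∑ k ∈ Finset.range m, (if d x < t (k + 1) then g k - g (k + 1) else 0) := by
          refine add_le_add le_rfl (Finset.sum_le_sum_of_subset_of_nonneg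
            (fun k hk => Finset.mem_range.2 (Finset.mem_Ico.1 hk).2) fun k hk _ => ?_)
          show (0 : ℝ) ≤ _
          split_ifs
          · exact hdiff k (Finset.mem_range.1 hk)
          · exact le_rfl
  calc ∑ x ∈ T, w x ≤ ∑ x ∈ T, (g m + ∑ k ∈ Finset.range m, (if d x < t (k + 1) then g k - g (k + 1) else 0)) :=
        Finset.sum_le_sum hpt
    _ = g m * T.card + ∑ k ∈ Finset.range m, (g k - g (k + 1)) * ((T.filter fun x => d x < t (k + 1)).card : ℝ) := by
        rw [Finset.sum_add_distrib, Finset.sum_const, nsmul_eq_mul, mul_comm, Finset.sum_comm]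
        congr 1
        refine Finset.sum_congr rfl fun k _ => ?_
        rw [← Finset.sum_filter, Finset.sum_const, nsmul_eq_mul, mul_comm]
    _ ≤ g m * NT + ∑ k ∈ Finset.range m, (g k - g (k + 1)) * N (k + 1) :=
        add_le_add (mul_le_mul_of_nonneg_left hNT hgm)
          (Finset.sum_le_sum fun k hk => mul_le_mul_of_nonneg_left (hN k (Finset.mem_range.1 hk)) (hdiff k (Finset.mem_range.1 hk)))

/-! ## The cored source count in level-monotone form -/

/-- The cap above a lower plane is bigger; the cap above `−ρ` is the whole ball. -/
theorem orthoCap_subset_of_le (b : OrthonormalBasis (Fin 3) ℝ E3) (c : E3) {t t' ρ : ℝ} (h : t' ≤ t ∨ t' ≤ -ρ) :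
    orthoCap b c t ρ ⊆ orthoCap b c t' ρ := by
  rintro x ⟨hxt, hxρ⟩
  refine ⟨?_, hxρ⟩
  rcases h with h | h
  · exact h.trans hxt
  · refine h.trans ?_
    have h1 : |⟪b 2, x - c⟫| ≤ ‖x - c‖ := by
      calc |⟪b 2, x - c⟫| ≤ ‖b 2‖ * ‖x - c‖ := abs_real_inner_le_norm _ _
        _ = ‖x - c‖ := by rw [b.orthonormal.1 2, one_mul]
    rw [← dist_eq_norm] at h1
    linarith [(abs_le.1 h1).1]

/-- The plane level `((ϱ')² − A'² − L²)/(2L)` is antitone in the level `L > 0` (when `A'² ≤ ϱ'²`... in fact whenever `0 ≤ (ϱ')² − A'² + Lℓ`). -/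
theorem capLevel_antitone {P L ℓ : ℝ} (hL : 0 < L) (hLℓ : L ≤ ℓ) (hP : 0 ≤ P) :
    (P - ℓ ^ 2) / (2 * ℓ) ≤ (P - L ^ 2) / (2 * L) := by
  have hℓ : 0 < ℓ := hL.trans_le hLℓ
  rw [div_le_div_iff₀ (by positivity) (by positivity)]
  nlinarith [mul_nonneg (sub_nonneg.2 hLℓ) (add_nonneg hP (mul_nonneg hL.le hℓ.le))]

/-- ★★ THE CORED COUNT, LEVEL-MONOTONE: window `(a,h)`, `g` isometry, member `c` with `0 < dist x₀ c ≤ ℓ`, `9/5 ≤ ϱ`, `(A + 9/5)² ≤ (ϱ − 9/5)²`;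
finite `T ⊆ g '' barlowStacking a h s` with `dist y c ≤ A`, `ϱ ≤ dist y x₀` on `T`; any plane level `t` with `−(A + 9/5) ≤ t ≤ A + 9/5` and
`t ≤ ((ϱ − 9/5)² − ℓ² − (A + 9/5)²)/(2ℓ) ∨ t ≤ −(A + 9/5)` ⟹ `#T · a(a√3/2)h ≤ capVol (A + 9/5) t`. -/
theorem card_mul_le_cap_of_level {a h : ℝ} {s : ℤ → ℤ} {g : E3 → E3}
    (ha : 9 / 10 ≤ a ∧ a ≤ 11 / 10) (hh : 0 < h ∧ 27 / 50 * a ^ 2 ≤ h ^ 2 ∧ h ^ 2 ≤ 121 / 150 * a ^ 2) (hg : Isometry g)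
    {x₀ c : E3} {A ϱ ℓ t : ℝ} (hL : 0 < dist x₀ c) (hℓ : dist x₀ c ≤ ℓ) (hϱ : 9 / 5 ≤ ϱ) (hAϱ : (A + 9 / 5) ^ 2 ≤ (ϱ - 9 / 5) ^ 2)
    (h1 : -(A + 9 / 5) ≤ t) (h2 : t ≤ A + 9 / 5)
    (ht : t ≤ ((ϱ - 9 / 5) ^ 2 - ℓ ^ 2 - (A + 9 / 5) ^ 2) / (2 * ℓ) ∨ t ≤ -(A + 9 / 5))
    (T : Finset E3) (hT : ↑T ⊆ g '' barlowStacking a h s) (hTA : ∀ y ∈ T, dist y c ≤ A) (hTϱ : ∀ y ∈ T, ϱ ≤ dist y x₀) :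
    (T.card : ℝ) * (a * (a * √3 / 2) * h) ≤ capVol (A + 9 / 5) t := by
  have ha0 : 0 ≤ a := by linarith [ha.1]
  have hV0 : 0 ≤ a * (a * √3 / 2) * h := by have := hh.1.le; positivity
  have hxc : x₀ ≠ c := fun h0 => by rw [h0, dist_self] at hL; exact lt_irrefl _ hL
  obtain ⟨b, hb⟩ := exists_orthonormalBasis_axis hxc
  set K : Set E3 := {z | dist z c ≤ A ∧ ϱ ≤ dist z x₀} with hK
  have hT' : ↑T ⊆ g '' barlowStacking a h s ∩ K := fun y hy => ⟨hT hy, hTA y (Finset.mem_coe.1 hy), hTϱ y (Finset.mem_coe.1 hy)⟩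
  have hc1 := card_mul_le_volume_near_of_subset_image ha hh hg K T hT'
  set t₀ : ℝ := ((ϱ - 9 / 5) ^ 2 - dist x₀ c ^ 2 - (A + 9 / 5) ^ 2) / (2 * dist x₀ c) with ht₀
  have hsub1 : {x : E3 | ∃ z ∈ K, dist x z ≤ 9 / 5} ⊆ orthoCap b c t₀ (A + 9 / 5) := by
    rintro x ⟨z, hz, hxz⟩
    exact near_cored_subset_cap hL hb hϱ ⟨z, hz, hxz⟩
  have ht' : t ≤ t₀ ∨ t ≤ -(A + 9 / 5) := by
    rcases ht with ht | ht
    · left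
      refine ht.trans ?_
      have e1 : ((ϱ - 9 / 5) ^ 2 - ℓ ^ 2 - (A + 9 / 5) ^ 2) = ((ϱ - 9 / 5) ^ 2 - (A + 9 / 5) ^ 2) - ℓ ^ 2 := by ring
      have e2 : t₀ = (((ϱ - 9 / 5) ^ 2 - (A + 9 / 5) ^ 2) - dist x₀ c ^ 2) / (2 * dist x₀ c) := by rw [ht₀]; ring
      rw [e1, e2]
      exact capLevel_antitone hL hℓ (sub_nonneg.2 hAϱ)
    · exact Or.inr ht
  have hsub2 := orthoCap_subset_of_le b c (ρ := A + 9 / 5) ht'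
  have hc2 := (hc1.trans (measure_mono hsub1)).trans ((measure_mono hsub2).trans_eq (volume_orthoCap_eq b c h1 h2))
  rw [← ENNReal.ofReal_natCast, ← ENNReal.ofReal_mul (Nat.cast_nonneg _),
    ENNReal.ofReal_le_ofReal_iff (capVol_nonneg (by linarith))] at hc2
  exact hc2

/-- ★ The same count from the band hypothesis `dist c x₀ ≤ ℓ` alone (`A < ϱ`): a member AT the core point has no source within `A`. -/
theorem card_mul_le_cap_of_level' {a h : ℝ} {s : ℤ → ℤ} {g : E3 → E3}
    (ha : 9 / 10 ≤ a ∧ a ≤ 11 / 10) (hh : 0 < h ∧ 27 / 50 * a ^ 2 ≤ h ^ 2 ∧ h ^ 2 ≤ 121 / 150 * a ^ 2) (hg : Isometry g)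
    {x₀ c : E3} {A ϱ ℓ t : ℝ} (hℓ : dist c x₀ ≤ ℓ) (hϱ : 9 / 5 ≤ ϱ) (hAϱ' : A < ϱ) (hAϱ : (A + 9 / 5) ^ 2 ≤ (ϱ - 9 / 5) ^ 2)
    (h1 : -(A + 9 / 5) ≤ t) (h2 : t ≤ A + 9 / 5)
    (ht : t ≤ ((ϱ - 9 / 5) ^ 2 - ℓ ^ 2 - (A + 9 / 5) ^ 2) / (2 * ℓ) ∨ t ≤ -(A + 9 / 5))
    (T : Finset E3) (hT : ↑T ⊆ g '' barlowStacking a h s) (hTA : ∀ y ∈ T, dist y c ≤ A) (hTϱ : ∀ y ∈ T, ϱ ≤ dist y x₀) :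
    (T.card : ℝ) * (a * (a * √3 / 2) * h) ≤ capVol (A + 9 / 5) t := by
  by_cases hL : 0 < dist x₀ c
  · exact card_mul_le_cap_of_level ha hh hg hL (by rwa [dist_comm] at hℓ) hϱ hAϱ h1 h2 ht T hT hTA hTϱ
  · have h0 : x₀ = c := by
      have := le_antisymm (not_lt.1 hL) dist_nonneg
      exact dist_eq_zero.1 this
    have hTe : T = ∅ := by
      refine Finset.eq_empty_iff_forall_notMem.2 fun y hy => ?_
      have h1 := hTA y hy; have h2 := hTϱ y hy; rw [h0] at h2; linarith
    rw [hTe, Finset.card_empty, Nat.cast_zero, zero_mul]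
    exact capVol_nonneg (by linarith)

/-- The plain ball count in the same currency: `#T·V ≤ 4π/3·(A + 9/5)³` for sources within `A ≥ 0` of the member. -/
theorem card_mul_le_ball {a h : ℝ} {s : ℤ → ℤ} {g : E3 → E3}
    (ha : 9 / 10 ≤ a ∧ a ≤ 11 / 10) (hh : 0 < h ∧ 27 / 50 * a ^ 2 ≤ h ^ 2 ∧ h ^ 2 ≤ 121 / 150 * a ^ 2) (hg : Isometry g)
    (c : E3) {A : ℝ} (hA : 0 ≤ A) (T : Finset E3) (hT : ↑T ⊆ g '' barlowStacking a h s) (hTA : ∀ y ∈ T, dist y c ≤ A) :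
    (T.card : ℝ) * (a * (a * √3 / 2) * h) ≤ 4 * Real.pi / 3 * (A + 9 / 5) ^ 3 :=
  card_mul_le_of_subset_barlowImage ha hh hg c hA T fun y hy => ⟨hT hy, Metric.mem_closedBall.2 (hTA y (Finset.mem_coe.1 hy))⟩

end RowSchema

end Summit.AtomisticToContinuum.Crystallization.Theorems.ChargedEnergyGapChartDial
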